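import Literature.NumberTheory.Automorphic.AutomorphicRepsGLAnalyticVectors
import Literature.NumberTheory.Automorphic.SelfDualUnitsInstances
import HarnessLib

/-!
# `cuspidal_analyticAt_rightRegular` from boundedness alone; Harish-Chandra's closure theorem
# for cusp forms on `GL_n` on the base `{cuspidal_bounded}`

Topic `NumberTheory/Automorphic`; assembly of `AutomorphicRepsGLAnalyticVectors` (the named fact
`AutomorphicRepsGL.cuspidal_analyticAt_rightRegular hcpt μ` of `AutomorphicRepsGLIrreducibleL2HC`
— analyticity of the `L²`-orbits `t ↦ R(exp tX) [f]` of classes of `A_G`-invariant cusp forms —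
proved from `cuspidal_bounded hcpt` and a self-dual system of units of `K_∞`) with
`SelfDualUnitsInstances` (the self-dual system `SelfDualUnits.mixedSpace K` of
`K_∞ = mixedSpace K = ℝ^{r₁} × ℂ^{r₂}`):

* `AutomorphicRepsGL.cuspidal_analyticAt_rightRegular_of_bounded`:
  **`cuspidal_bounded hcpt → cuspidal_analyticAt_rightRegular hcpt μ`** (Harish-Chandra 1953,
  Lemma 34, for cusp forms on `GL_n`, by Nelson's method; trust base `{cuspidal_bounded}`,
  Getz–Hahn 2024, Thm. 9.8.1).
* Consequences through the proved reductions of `AutomorphicRepsGLIrreducibleL2HC`: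
  `cuspidal_closure_exp_invariant_of_bounded` (Harish-Chandra's closure theorem, Cor. to
  Thm. 2, for every stable space of `A_G`-invariant cusp forms: base `{cuspidal_bounded}`),
  `formsOfL2_closure_exp_invariant_of_bounded` (Step 3a of Borel–Jacquet 4.6,
  `AutomorphicRepsGLCuspidalL2Step3`, base `{cuspidal_bounded}`),
  `exists_le_formsOfL2_of_W'_eq_bot_of_bounded_of_exists_mem` and
  `exists_isAssociatedL2_of_bounded_of_exists_mem` (the realisation of irreducible spaces of
  cusp forms in `L²_cusp`, base `{cuspidal_bounded, cuspidal_closure_exists_mem_l2OfForms}` plus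
  `cuspidal_W'_eq_bot`, `formsOfL2_irreducible` for the latter).

Everything here is proved; no definition.

## References

* Harish-Chandra, *Representations of a semisimple Lie group on a Banach space. I*, Trans. AMS 75
  (1953), 185–243: Cor. to Thm. 2 (p. 211), Lemma 34 (p. 228) [HarishChandraTAMS1953].
* E. Nelson, *Analytic vectors*, Ann. of Math. 70 (1959), 572–615 [Nelson1959].
* J. R. Getz, H. Hahn, *An Introduction to Automorphic Representations*, GTM 300 (2024):
  Thm. 9.8.1, proof of Thm. 6.5.1 (p. 192) [GetzHahn2024].
* A. Borel, H. Jacquet, *Automorphic forms and automorphic representations*, Proc. Sympos. Pure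
  Math. 33 (1979), Part 1, 4.6 [BorelJacquetCorvallis1979].
-/

open scoped MatrixGroups
open NumberField NumberField.mixedEmbedding IsDedekindDomain
open _root_.MeasureTheory

noncomputable section

namespace Literature.NumberTheory.Automorphic

variable {n : ℕ} {K : Type} [Field K] [NumberField K] {hcpt : isCompact_glFiniteIntegralLevel n K}
  {μ : Measure (AdelicGroupData.gl n K).automorphicQuotient}
  [(AdelicGroupData.gl n K).IsAutomorphicMeasure μ]

/-- **`K`-finite `Z(𝔤)`-finite cusp forms are analytic vectors of `L²` along the one-parameter
subgroups, granted boundedness.** `cuspidal_bounded hcpt` (Getz–Hahn 2024, Thm. 9.8.1) implies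
the named fact `AutomorphicRepsGL.cuspidal_analyticAt_rightRegular hcpt μ` of
`AutomorphicRepsGLIrreducibleL2HC`: for a `(𝔤, K_∞) × GL_n(𝔸_K^∞)`-stable space `W` of
`A_G`-invariant cusp forms, `f ∈ ℒ²(μ)` with `invQuot f ∈ W` and `X ∈ 𝔤`, the orbit
`t ↦ R(exp tX) [f]` is real analytic on `ℝ` as a map into `L²(GL_n(𝔸_K) ⧸ A_G GL_n(K), μ)`
(`cuspidal_analyticAt_rightRegular_of_bounded_of_selfDualUnits` with the self-dual system
`SelfDualUnits.mixedSpace K` of `K_∞`). Harish-Chandra 1953, Lemma 34 (p. 228), proved here by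
Nelson's method (Nelson 1959, §8). [cite: HarishChandraTAMS1953, Lemma 34 (p. 228)] -/
theorem AutomorphicRepsGL.cuspidal_analyticAt_rightRegular_of_bounded
    (hb : AutomorphicRepsGL.cuspidal_bounded hcpt) :
    AutomorphicRepsGL.cuspidal_analyticAt_rightRegular hcpt μ :=
  -- the `Fintype` instance of the index type of `SelfDualUnits.mixedSpace K` (classical
  -- decidability on the infinite places) is taken from that term by unification (`(_)`)
  @AutomorphicRepsGL.cuspidal_analyticAt_rightRegular_of_bounded_of_selfDualUnits n K _ _ hcpt μ _
    _ (_) hb (SelfDualUnits.mixedSpace K)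

/-- **Harish-Chandra's closure theorem for cusp forms on `GL_n` from boundedness alone**:
`cuspidal_bounded hcpt` implies `cuspidal_closure_exp_invariant hcpt μ` — the `L²`-closure of
the classes of a stable space of `A_G`-invariant cusp forms is invariant under `R(exp X)`,
`X ∈ 𝔤` (`cuspidal_closure_exp_invariant_of_analytic` with
`cuspidal_analyticAt_rightRegular_of_bounded`). Harish-Chandra 1953, Cor. to Thm. 2 (p. 211).
[cite: HarishChandraTAMS1953, Cor. to Thm. 2 (p. 211)] -/
theorem AutomorphicRepsGL.cuspidal_closure_exp_invariant_of_bounded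
    (hb : AutomorphicRepsGL.cuspidal_bounded hcpt) :
    AutomorphicRepsGL.cuspidal_closure_exp_invariant hcpt μ :=
  AutomorphicRepsGL.cuspidal_closure_exp_invariant_of_analytic hb
    (AutomorphicRepsGL.cuspidal_analyticAt_rightRegular_of_bounded hb)

/-- **Step 3a of Borel–Jacquet 4.6 from boundedness alone**: `cuspidal_bounded hcpt` implies the
named fact `formsOfL2_closure_exp_invariant hcpt μ` of `AutomorphicRepsGLCuspidalL2Step3` (the
closure of the classes of a stable `W ≤ V_Π` is `R(exp X)`-invariant).
Harish-Chandra 1953, Cor. to Thm. 2 (p. 211); Borel–Jacquet 1979, 4.6. [cite: HarishChandraTAMS1953, Cor. to Thm. 2 (p. 211)] -/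
theorem AutomorphicRepsGL.formsOfL2_closure_exp_invariant_of_bounded
    (hb : AutomorphicRepsGL.cuspidal_bounded hcpt) :
    AutomorphicRepsGL.formsOfL2_closure_exp_invariant hcpt μ :=
  AutomorphicRepsGL.formsOfL2_closure_exp_invariant_of_analytic hb
    (AutomorphicRepsGL.cuspidal_analyticAt_rightRegular_of_bounded hb)

/-- **The realisation of irreducible spaces of cusp forms in `L²_cusp` on the base
`{cuspidal_bounded, cuspidal_closure_exists_mem_l2OfForms}`**: an irreducible stable space of
`A_G`-invariant cusp forms on `GL_n(𝔸_K)` lies in `V_Π` for an irreducible closed invariant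
`Π ≤ L²_cusp` (`exists_le_formsOfL2_of_W'_eq_bot_of_analytic` with
`cuspidal_analyticAt_rightRegular_of_bounded`). Borel–Jacquet 1979, 4.6; Harish-Chandra 1953,
Cor. to Thm. 2 and Thm. 5. [cite: BorelJacquetCorvallis1979, 4.6] -/
theorem AutomorphicRepsGL.exists_le_formsOfL2_of_W'_eq_bot_of_bounded_of_exists_mem
    (hb : AutomorphicRepsGL.cuspidal_bounded hcpt)
    (h₃ : AutomorphicRepsGL.cuspidal_closure_exists_mem_l2OfForms hcpt μ) :
    AutomorphicRepsGL.exists_le_formsOfL2_of_W'_eq_bot hcpt μ :=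
  AutomorphicRepsGL.exists_le_formsOfL2_of_W'_eq_bot_of_analytic hb
    (AutomorphicRepsGL.cuspidal_analyticAt_rightRegular_of_bounded hb) h₃

/-- **`exists_isAssociatedL2` on the base `{cuspidal_W'_eq_bot, cuspidal_bounded,
cuspidal_closure_exists_mem_l2OfForms, formsOfL2_irreducible}`**
(`exists_isAssociatedL2_of_analytic` with `cuspidal_analyticAt_rightRegular_of_bounded`).
Borel–Jacquet 1979, 4.4–4.6. [cite: BorelJacquetCorvallis1979, 4.4–4.6] -/
theorem AutomorphicRepsGL.exists_isAssociatedL2_of_bounded_of_exists_mem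
    (hss : cuspidal_W'_eq_bot hcpt) (hb : AutomorphicRepsGL.cuspidal_bounded hcpt)
    (h₃ : AutomorphicRepsGL.cuspidal_closure_exists_mem_l2OfForms hcpt μ)
    (h₄ : AutomorphicRepsGL.formsOfL2_irreducible hcpt μ) :
    AutomorphicRepsGL.exists_isAssociatedL2 hcpt μ :=
  AutomorphicRepsGL.exists_isAssociatedL2_of_analytic hss hb
    (AutomorphicRepsGL.cuspidal_analyticAt_rightRegular_of_bounded hb) h₃ h₄

end Literature.NumberTheory.Automorphic
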